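import Mathlib
import Literature.NumberTheory.LFunctions.Zhang2022.KnifeEdgeInvisibleTail
import Literature.NumberTheory.LFunctions.Zhang2022.Section11AFEObjects
import Literature.NumberTheory.LFunctions.Zhang2022.SkeletonAssembly

/-!
# The invisible tail over Zhang's family (F-S2 transfer card, Part D)

Companion to `KnifeEdgeInvisibleTail.lean` (the engine: Pólya–Vinogradov with general weights + the smooth-profile
tail bound `norm_sum_Ioc_char_profile_cpow_le`), kept in a separate module because it needs the family objects
(`Skeleton.pc`, `Skeleton.psiChi`, `Skeleton.psiChiPrimitive_holds`, `Section11AFE.psiChi_natCast`) whose modules sit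
high in the Zhang2022 import graph, while the engine should stay importable low in it.

Main result `tailInvisible`: for `0 < ε`, `0 < δ` there is `C > 0` with, for all large `D`, every primitive quadratic
`χ (mod D)`, every `x = (p, ψ) ∈ Ψ`, every 1-Lipschitz `g`, `‖g‖ ≤ 1`, every `s` with `½ − 1/log P ≤ Re s ≤ 2`,
`|Im s| ≤ 8t₀`, every block `P^{1+ε} ≤ X ≤ Y ≤ P^{1+δ}`:
`‖Σ_{X<n≤Y} χψ(n) g(log n/log P) n^{−s}‖ ≤ C·P^{−ε/4}` — literally the Prop `TailInvisible δ ε` of the card's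
`Sketch.lean`.  WHAT THIS IS NOT: a claim about Theorems 1–2 of arXiv:2211.02515, about Landau–Siegel zeros, or about
Parity; it is a pointwise size statement about smooth-profile character polynomials (classical tools only).
-/

namespace Literature.NumberTheory.LFunctions.Zhang2022.KnifeEdgeInvisibleTail

open Finset

/-! ## D. The invisible tail over Zhang's family `Ψ` (the card's `TailInvisible δ ε`, now a theorem)

For the member `x = (p, ψ)` of the family and the primitive quadratic `χ (mod D)`, `Skeleton.pc χ x n = χψ(n)` is the
value of the primitive character `χψ (mod Dp)` (the tree's `Section11AFE.psiChi_natCast`,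
`Skeleton.psiChiPrimitive_holds`), so `norm_sum_Ioc_char_profile_cpow_le` applies with `q = Dp ≤ 3DP`,
`L = log P = 𝓛⁹`; on `Re s ≥ ½ − 1/log P`, `|Im s| ≤ 8t₀`, `P^{1+ε} ≤ X ≤ Y ≤ P^{1+δ}` the bound is
`≤ 4(52+δ)e^{2+ε} · exp(528.5𝓛 − ε𝓛⁹/2) ≤ C·P^{−ε/4}` as soon as `𝓛 ≥ max(4, 2116/ε)`. -/

section Family

open Skeleton

/-- `p ≤ 3P` for a member of the family (`P < p < P(1 + 𝓛⁻⁶⁸)`). [cite: Zhang2022LandauSiegel, §2 p. 4] -/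
private theorem chr_p_le_three_mul_bigP' {D : ℕ} (x : Chr D) (hL : 1 ≤ ell D) : (x.p : ℝ) ≤ 3 * bigP D := by
  have hm := x.mem
  rw [primeWindow, Finset.mem_filter, Finset.mem_Ioo] at hm
  have hP : 0 < bigP D := Real.exp_pos _
  have hP1 : 1 ≤ bigP D := by rw [bigP]; exact Real.one_le_exp (by positivity)
  have hℓ : (ell D ^ 68)⁻¹ ≤ 1 := inv_le_one_of_one_le₀ (one_le_pow₀ hL)
  have h1 : (x.p : ℝ) < ⌈bigP D * (1 + (ell D ^ 68)⁻¹)⌉₊ := by exact_mod_cast hm.1.2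
  have h2 : (⌈bigP D * (1 + (ell D ^ 68)⁻¹)⌉₊ : ℝ) < bigP D * (1 + (ell D ^ 68)⁻¹) + 1 :=
    Nat.ceil_lt_add_one (by positivity)
  nlinarith

/-- `L ≤ log D` once `⌈e^L⌉ ≤ D`. [folklore] -/
private theorem le_ell_of_ceil_exp_le {L₀ : ℝ} {D : ℕ} (hD : ⌈Real.exp L₀⌉₊ ≤ D) : L₀ ≤ ell D := by
  have h : Real.exp L₀ ≤ (D : ℝ) := (Nat.le_ceil _).trans (by exact_mod_cast hD)
  exact (Real.le_log_iff_exp_le (lt_of_lt_of_le (Real.exp_pos _) h)).mpr h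

/-- `L^n ≤ e^{nL}` for `L ≥ 0`. [folklore] -/
private theorem pow_le_exp_mul {L : ℝ} (hL : 0 ≤ L) (n : ℕ) : L ^ n ≤ Real.exp (n * L) := by
  have h1 : L ≤ Real.exp L := by have := Real.add_one_le_exp L; linarith
  calc L ^ n ≤ Real.exp L ^ n := pow_le_pow_left₀ hL h1 n
    _ = Real.exp (n * L) := by rw [← Real.exp_nat_mul]

/-- Bookkeeping (i): `√q (1 + log q) ≤ e^{(𝓛+2)/2} e^{𝓛⁹/2} · 4𝓛⁹` for `q ≤ 3 D P`, `D = e^𝓛`, `P = e^{𝓛⁹}`.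
[folklore] -/
private theorem budget_sqrt_log {ℓ Dr q : ℝ} (hℓ4 : 4 ≤ ℓ) (hDr : Real.exp ℓ = Dr) (hq1 : 1 ≤ q)
    (hq : q ≤ 3 * (Dr * Real.exp (ℓ ^ 9))) :
    Real.sqrt q * (1 + Real.log q) ≤ (Real.exp ((ℓ + 2) / 2) * Real.exp (ℓ ^ 9 / 2)) * (4 * ℓ ^ 9) := by
  have hℓ1 : 1 ≤ ℓ := by linarith
  have hℓ9 : ℓ ≤ ℓ ^ 9 := by
    calc ℓ = ℓ ^ 1 := (pow_one ℓ).symm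
      _ ≤ ℓ ^ 9 := pow_le_pow_right₀ hℓ1 (by norm_num)
  have hDr0 : 0 < Dr := by rw [← hDr]; exact Real.exp_pos _
  have h3e : (3 : ℝ) ≤ Real.exp 2 := by have := Real.add_one_le_exp (2:ℝ); linarith
  have hsqrt : Real.sqrt q ≤ Real.exp ((ℓ + 2) / 2) * Real.exp (ℓ ^ 9 / 2) := by
    have h1 : q ≤ Real.exp (ℓ + 2) * Real.exp (ℓ ^ 9) := by
      calc q ≤ 3 * (Dr * Real.exp (ℓ ^ 9)) := hq
        _ = 3 * Real.exp ℓ * Real.exp (ℓ ^ 9) := by rw [hDr]; ring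
        _ ≤ Real.exp 2 * Real.exp ℓ * Real.exp (ℓ ^ 9) := by gcongr
        _ = Real.exp (ℓ + 2) * Real.exp (ℓ ^ 9) := by rw [Real.exp_add]; ring
    calc Real.sqrt q ≤ Real.sqrt (Real.exp (ℓ + 2) * Real.exp (ℓ ^ 9)) := Real.sqrt_le_sqrt h1
      _ = Real.sqrt (Real.exp (ℓ + 2)) * Real.sqrt (Real.exp (ℓ ^ 9)) :=
          Real.sqrt_mul (Real.exp_pos _).le _
      _ = Real.exp ((ℓ + 2) / 2) * Real.exp (ℓ ^ 9 / 2) := by rw [← Real.exp_half, ← Real.exp_half]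
  have hlog3 : Real.log 3 ≤ 2 := by
    have := Real.log_le_sub_one_of_pos (by norm_num : (0:ℝ) < 3); linarith
  have hlogq : 1 + Real.log q ≤ 4 * ℓ ^ 9 := by
    have h1 : Real.log q ≤ Real.log (3 * (Dr * Real.exp (ℓ ^ 9))) := Real.log_le_log (by linarith) hq
    have h2 : Real.log (3 * (Dr * Real.exp (ℓ ^ 9))) = Real.log 3 + ℓ + ℓ ^ 9 := by
      rw [Real.log_mul (by norm_num) (mul_pos hDr0 (Real.exp_pos _)).ne',
        Real.log_mul hDr0.ne' (Real.exp_pos _).ne', Real.log_exp, ← hDr, Real.log_exp]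
      ring
    linarith
  have hlq0 : 0 ≤ 1 + Real.log q := by have := Real.log_nonneg hq1; linarith
  exact mul_le_mul hsqrt hlogq hlq0 (mul_nonneg (Real.exp_pos _).le (Real.exp_pos _).le)

/-- Bookkeeping (ii): `X^{−σ} ≤ e^{−(1+ε)𝓛⁹/2 + (1+ε)}` for `X ≥ P^{1+ε}`, `σ ≥ ½ − 1/𝓛⁹`, `σ > 0`. [folklore] -/
private theorem budget_X {ℓ ε σ X : ℝ} (hε : 0 < ε) (hℓ0 : 0 < ℓ) (hσ1 : 1 / 2 - 1 / ℓ ^ 9 ≤ σ) (hσ0 : 0 < σ)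
    (hX : Real.exp (ℓ ^ 9) ^ (1 + ε) ≤ X) :
    X ^ (-σ) ≤ Real.exp (-((1 + ε) * ℓ ^ 9 / 2) + (1 + ε)) := by
  have hP : 0 < Real.exp (ℓ ^ 9) := Real.exp_pos _
  have h1 : X ^ (-σ) ≤ (Real.exp (ℓ ^ 9) ^ (1 + ε)) ^ (-σ) :=
    Real.rpow_le_rpow_of_nonpos (Real.rpow_pos_of_pos hP _) hX (by linarith)
  have h2 : (Real.exp (ℓ ^ 9) ^ (1 + ε)) ^ (-σ) = Real.exp (-((1 + ε) * σ * ℓ ^ 9)) := by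
    rw [← Real.exp_mul, ← Real.exp_mul]; ring_nf
  have hexpo : -((1 + ε) * σ * ℓ ^ 9) ≤ -((1 + ε) * ℓ ^ 9 / 2) + (1 + ε) := by
    have hℓ9pos : 0 < ℓ ^ 9 := by positivity
    have h3 : (1 + ε) * ℓ ^ 9 * (1 / 2 - 1 / ℓ ^ 9) ≤ (1 + ε) * ℓ ^ 9 * σ :=
      mul_le_mul_of_nonneg_left hσ1 (mul_nonneg (by linarith) hℓ9pos.le)
    have h4 : (1 + ε) * ℓ ^ 9 * (1 / 2 - 1 / ℓ ^ 9) = (1 + ε) * ℓ ^ 9 / 2 - (1 + ε) := by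
      field_simp
    nlinarith
  rw [h2] at h1
  exact h1.trans (Real.exp_le_exp.mpr hexpo)

/-- Bookkeeping (iii): the bracket `1 + (log Y − log X)/𝓛⁹ + ‖s‖(1 + 1/σ)` lies in `[0, (52+δ)𝓛⁵¹⁹]`. [folklore] -/
private theorem budget_bracket {ℓ δ σ ns X Y : ℝ} (hδ : 0 < δ) (hℓ1 : 1 ≤ ℓ) (h14 : 1 / 4 ≤ σ)
    (hns0 : 0 ≤ ns) (hns : ns ≤ 2 + 8 * ℓ ^ 519) (hX1 : 1 ≤ X) (hXY : X ≤ Y)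
    (hY : Y ≤ Real.exp (ℓ ^ 9) ^ (1 + δ)) :
    0 ≤ 1 + (Real.log Y - Real.log X) / ℓ ^ 9 + ns * (1 + 1 / σ) ∧
      1 + (Real.log Y - Real.log X) / ℓ ^ 9 + ns * (1 + 1 / σ) ≤ (52 + δ) * ℓ ^ 519 := by
  have hℓ0 : 0 < ℓ := by linarith
  have hℓ9pos : 0 < ℓ ^ 9 := by positivity
  have hσ0 : 0 < σ := by linarith
  have hσ4 : 1 / σ ≤ 4 := by rw [div_le_iff₀ hσ0]; linarith
  have hσinv0 : 0 < 1 / σ := one_div_pos.mpr hσ0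
  have hX0 : 0 < X := by linarith
  have hY0 : 0 < Y := by linarith
  have hlogX0 : 0 ≤ Real.log X := Real.log_nonneg hX1
  have hlogXY : Real.log X ≤ Real.log Y := Real.log_le_log hX0 hXY
  have hlogY : Real.log Y ≤ (1 + δ) * ℓ ^ 9 := by
    have h1 : Real.log Y ≤ Real.log (Real.exp (ℓ ^ 9) ^ (1 + δ)) := Real.log_le_log hY0 hY
    rwa [Real.log_rpow (Real.exp_pos _), Real.log_exp] at h1
  have hA0 : 0 ≤ (Real.log Y - Real.log X) / ℓ ^ 9 := div_nonneg (by linarith) hℓ9pos.le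
  have hA : (Real.log Y - Real.log X) / ℓ ^ 9 ≤ 1 + δ := by
    rw [div_le_iff₀ hℓ9pos]; nlinarith
  have hB0 : 0 ≤ ns * (1 + 1 / σ) := mul_nonneg hns0 (by linarith)
  have hB : ns * (1 + 1 / σ) ≤ (2 + 8 * ℓ ^ 519) * 5 := by
    have h519 : 0 ≤ ℓ ^ 519 := pow_nonneg hℓ0.le 519
    exact mul_le_mul hns (by linarith) (by linarith) (by linarith)
  have h519 : 1 ≤ ℓ ^ 519 := one_le_pow₀ hℓ1
  have hd : δ ≤ δ * ℓ ^ 519 := le_mul_of_one_le_right hδ.le h519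
  constructor
  · linarith
  · linarith

/-- Bookkeeping (iv): the assembled exponent comparison, valid once `𝓛 ≥ 1` and `ε𝓛 ≥ 2116`. [folklore] -/
private theorem budget_final {ℓ ε δ : ℝ} (hε : 0 < ε) (hδ : 0 < δ) (hℓ1 : 1 ≤ ℓ) (hℓε : 2116 / ε ≤ ℓ) :
    (Real.exp ((ℓ + 2) / 2) * Real.exp (ℓ ^ 9 / 2)) * (4 * ℓ ^ 9) *
        (Real.exp (-((1 + ε) * ℓ ^ 9 / 2) + (1 + ε)) * ((52 + δ) * ℓ ^ 519)) ≤
      4 * (52 + δ) * Real.exp (2 + ε) * Real.exp (ℓ ^ 9 * (-(ε / 4))) := by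
  have hℓ0 : 0 ≤ ℓ := by linarith
  have hC0 : (0 : ℝ) ≤ 4 * (52 + δ) := by linarith
  have hpoly : 4 * ℓ ^ 9 * ((52 + δ) * ℓ ^ 519) ≤ 4 * (52 + δ) * Real.exp (528 * ℓ) := by
    have h1 : ℓ ^ 528 ≤ Real.exp ((528 : ℕ) * ℓ) := pow_le_exp_mul hℓ0 528
    have h2 : 4 * ℓ ^ 9 * ((52 + δ) * ℓ ^ 519) = 4 * (52 + δ) * ℓ ^ 528 := by ring
    rw [h2]
    push_cast at h1
    exact mul_le_mul_of_nonneg_left h1 hC0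
  have hfin : (ℓ + 2) / 2 + ℓ ^ 9 / 2 + (-((1 + ε) * ℓ ^ 9 / 2) + (1 + ε)) + 528 * ℓ ≤
      (2 + ε) + ℓ ^ 9 * (-(ε / 4)) := by
    have h1 : 2116 ≤ ε * ℓ := by rwa [div_le_iff₀' hε] at hℓε
    have h7 : 1 ≤ ℓ ^ 7 := one_le_pow₀ hℓ1
    have h2 : 2116 * ℓ ≤ ε * ℓ ^ 9 := by
      calc 2116 * ℓ ≤ ε * ℓ * ℓ := by nlinarith
        _ = ε * ℓ ^ 2 * 1 := by ring
        _ ≤ ε * ℓ ^ 2 * ℓ ^ 7 := by gcongr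
        _ = ε * ℓ ^ 9 := by ring
    nlinarith
  have hE : Real.exp ((ℓ + 2) / 2 + ℓ ^ 9 / 2 + (-((1 + ε) * ℓ ^ 9 / 2) + (1 + ε))) =
      Real.exp ((ℓ + 2) / 2) * Real.exp (ℓ ^ 9 / 2) * Real.exp (-((1 + ε) * ℓ ^ 9 / 2) + (1 + ε)) := by
    rw [Real.exp_add, Real.exp_add]
  calc (Real.exp ((ℓ + 2) / 2) * Real.exp (ℓ ^ 9 / 2)) * (4 * ℓ ^ 9) *
        (Real.exp (-((1 + ε) * ℓ ^ 9 / 2) + (1 + ε)) * ((52 + δ) * ℓ ^ 519))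
      = (4 * ℓ ^ 9 * ((52 + δ) * ℓ ^ 519)) *
        Real.exp ((ℓ + 2) / 2 + ℓ ^ 9 / 2 + (-((1 + ε) * ℓ ^ 9 / 2) + (1 + ε))) := by
        rw [hE]; ring
    _ ≤ (4 * (52 + δ) * Real.exp (528 * ℓ)) *
        Real.exp ((ℓ + 2) / 2 + ℓ ^ 9 / 2 + (-((1 + ε) * ℓ ^ 9 / 2) + (1 + ε))) :=
        mul_le_mul_of_nonneg_right hpoly (Real.exp_pos _).le
    _ = 4 * (52 + δ) *
        Real.exp ((ℓ + 2) / 2 + ℓ ^ 9 / 2 + (-((1 + ε) * ℓ ^ 9 / 2) + (1 + ε)) + 528 * ℓ) := by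
        rw [Real.exp_add _ (528 * ℓ)]; ring
    _ ≤ 4 * (52 + δ) * Real.exp ((2 + ε) + ℓ ^ 9 * (-(ε / 4))) :=
        mul_le_mul_of_nonneg_left (Real.exp_le_exp.mpr hfin) hC0
    _ = 4 * (52 + δ) * Real.exp (2 + ε) * Real.exp (ℓ ^ 9 * (-(ε / 4))) := by
        rw [Real.exp_add]; ring

/-- **The invisible tail** (literally the Prop `TailInvisible δ ε` of the F-S2 transfer card's `Sketch.lean`, for
`0 < ε`, `0 < δ`): there is `C > 0` such that for all large `D`, every primitive quadratic `χ (mod D)`, every member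
`x = (p, ψ)` of the family `Ψ`, every 1-Lipschitz profile `g` with `‖g‖ ≤ 1`, every `s` with
`½ − 1/log P ≤ Re s ≤ 2`, `|Im s| ≤ 8t₀`, and every block `P^{1+ε} ≤ X ≤ Y ≤ P^{1+δ}`,
`‖Σ_{X<n≤Y} χψ(n) g(log n/log P) n^{−s}‖ ≤ C · P^{−ε/4}`: the part of a smooth-profile polynomial beyond
`P^{1+ε}` is invisible at every point of the critical range (Pólya–Vinogradov for `χψ mod Dp` + Abel;
`√(Dp)·polylog ≤ P^{1/2+o(1)}` against `X^{−Re s} ≤ P^{−(1+ε)/2 + o(1)}`).  Not a statement about any particular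
`θ`-length mollifier: it says only that smooth-class coefficients beyond `P^{1+ε}` cannot be seen pointwise.
[cite: MontgomeryVaughan2007, Thm 9.18] [cite: Zhang2022LandauSiegel, §4 p. 8; §7 (7.2)] -/
theorem tailInvisible {δ ε : ℝ} (hε : 0 < ε) (hδ : 0 < δ) :
    ∃ C : ℝ, 0 < C ∧ Skeleton.ForAllLarge fun D _ χ =>
      ∀ (x : Skeleton.Chr D) (g : ℝ → ℂ), LipschitzWith 1 g → (∀ z, ‖g z‖ ≤ 1) →
        ∀ s : ℂ, 1 / 2 - 1 / Real.log (Skeleton.bigP D) ≤ s.re → s.re ≤ 2 → |s.im| ≤ 8 * Skeleton.t0 D →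
          ∀ X Y : ℕ, Skeleton.bigP D ^ (1 + ε) ≤ (X : ℝ) → X ≤ Y → (Y : ℝ) ≤ Skeleton.bigP D ^ (1 + δ) →
            ‖∑ n ∈ Finset.Ioc X Y, Skeleton.pc χ x n * g (Real.log n / Real.log (Skeleton.bigP D)) *
                (n : ℂ) ^ (-s)‖ ≤ C * Skeleton.bigP D ^ (-(ε / 4)) := by
  have hC : 0 < 4 * (52 + δ) * Real.exp (2 + ε) := mul_pos (by linarith) (Real.exp_pos _)
  refine ⟨4 * (52 + δ) * Real.exp (2 + ε), hC, ?_⟩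
  refine Skeleton.ForAllLarge.of_le ⌈Real.exp (max 4 (2116 / ε))⌉₊ ?_
  intro D _ χ hD _hquad hχ x g hg hg1 s hσ1 hσ2 hsim X Y hX hXY hY
  -- parameters
  have hℓ : max 4 (2116 / ε) ≤ ell D := le_ell_of_ceil_exp_le hD
  have hℓ4 : 4 ≤ ell D := le_trans (le_max_left _ _) hℓ
  have hℓε : 2116 / ε ≤ ell D := le_trans (le_max_right _ _) hℓ
  have hℓ1 : 1 ≤ ell D := by linarith
  have hℓ0 : 0 < ell D := by linarith
  have hP : 0 < bigP D := Real.exp_pos _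
  have hlogP : Real.log (bigP D) = ell D ^ 9 := by rw [bigP, Real.log_exp]
  have hℓ9 : ell D ≤ ell D ^ 9 := by
    calc ell D = ell D ^ 1 := (pow_one _).symm
      _ ≤ ell D ^ 9 := pow_le_pow_right₀ hℓ1 (by norm_num)
  have hlogP4 : 4 ≤ Real.log (bigP D) := by rw [hlogP]; linarith
  have hlogPpos : 0 < Real.log (bigP D) := by linarith
  -- `D ≥ 3`, `q = Dp ≥ 2`, `χψ` primitive
  have hDpos : (0 : ℝ) < D := by exact_mod_cast Nat.pos_of_ne_zero (NeZero.ne D)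
  have hexpℓ : Real.exp (ell D) = D := by rw [ell]; exact Real.exp_log hDpos
  have hD3r : (3 : ℝ) ≤ D := by
    have h2 : Real.exp 4 ≤ Real.exp (ell D) := Real.exp_le_exp.mpr hℓ4
    have h3 : (4 : ℝ) + 1 ≤ Real.exp 4 := Real.add_one_le_exp 4
    linarith
  have hD3 : 3 ≤ D := by exact_mod_cast hD3r
  have hp2 : 2 ≤ x.p := x.prime.two_le
  have hq : 2 ≤ D * x.p := le_trans (by norm_num) (Nat.mul_le_mul hD3 hp2)
  have hprim : (psiChi χ x).IsPrimitive := psiChiPrimitive_holds D χ x hD3 hχ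
  -- `s`
  have hinv4 : 1 / Real.log (bigP D) ≤ 1 / 4 := one_div_le_one_div_of_le (by norm_num) hlogP4
  have hσpos : 0 < s.re := by linarith
  have h14 : 1 / 4 ≤ s.re := by linarith
  have hsnorm : ‖s‖ ≤ 2 + 8 * ell D ^ 519 := by
    have h1 := Complex.norm_le_abs_re_add_abs_im s
    have h2 : |s.re| ≤ 2 := abs_le.mpr ⟨by linarith, hσ2⟩
    have h3 : |s.im| ≤ 8 * ell D ^ 519 := by simpa only [t0] using hsim
    linarith
  -- `X`, `Y`
  have hP1 : 1 ≤ bigP D := by rw [bigP]; exact Real.one_le_exp (by positivity)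
  have hX1r : (1 : ℝ) ≤ X := le_trans (Real.one_le_rpow hP1 (by linarith)) hX
  have hX1 : 1 ≤ X := by exact_mod_cast hX1r
  have hX0 : (0 : ℝ) < X := by linarith
  have hXYr : (X : ℝ) ≤ Y := by exact_mod_cast hXY
  -- the engine, for `θ = χψ (mod Dp)`, `L = log P`
  have key := norm_sum_Ioc_char_profile_cpow_le hq hprim hg hg1 hlogPpos hσpos hX1 hXY
  have hsum : ∑ n ∈ Finset.Ioc X Y, Skeleton.pc χ x n * g (Real.log n / Real.log (Skeleton.bigP D)) *
      (n : ℂ) ^ (-s) = ∑ n ∈ Finset.Ioc X Y, psiChi χ x (n : ZMod (D * x.p)) *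
        (g (Real.log n / Real.log (Skeleton.bigP D)) * (n : ℂ) ^ (-s)) := by
    refine Finset.sum_congr rfl fun n _ => ?_
    rw [Section11AFE.psiChi_natCast, mul_assoc]
  rw [hsum]
  refine key.trans ?_
  rw [hlogP]
  -- bookkeeping
  have hqr : ((D * x.p : ℕ) : ℝ) ≤ 3 * ((D : ℝ) * Real.exp (ell D ^ 9)) := by
    have := chr_p_le_three_mul_bigP' x hℓ1
    rw [bigP] at this
    push_cast
    nlinarith
  have hq1 : (1 : ℝ) ≤ ((D * x.p : ℕ) : ℝ) := by exact_mod_cast le_trans (by norm_num) hq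
  have hi := budget_sqrt_log hℓ4 hexpℓ hq1 hqr
  have hσ1' : 1 / 2 - 1 / ell D ^ 9 ≤ s.re := by rwa [hlogP] at hσ1
  have hX' : Real.exp (ell D ^ 9) ^ (1 + ε) ≤ (X : ℝ) := by rwa [bigP] at hX
  have hY' : (Y : ℝ) ≤ Real.exp (ell D ^ 9) ^ (1 + δ) := by rwa [bigP] at hY
  have hii := budget_X hε hℓ0 hσ1' hσpos hX'
  have hiii := budget_bracket hδ hℓ1 h14 (norm_nonneg s) hsnorm hX1r hXYr hY'
  have hiv := budget_final hε hδ hℓ1 hℓε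
  have hPε : bigP D ^ (-(ε / 4)) = Real.exp (ell D ^ 9 * (-(ε / 4))) := by rw [bigP, ← Real.exp_mul]
  rw [hPε]
  refine le_trans ?_ hiv
  exact mul_le_mul hi (mul_le_mul hii hiii.2 hiii.1 (Real.exp_pos _).le)
    (mul_nonneg (Real.rpow_nonneg hX0.le _) hiii.1)
    (mul_nonneg (mul_nonneg (Real.exp_pos _).le (Real.exp_pos _).le) (by positivity))

/-! ## E. The invisible tail for the NON-SMOOTH class: profiles of bounded variation (LS programme, family B-multi)

Cell `landau-siegel` (rung F-S3), sub-cell §B-multi, registry row «E-multi-farjump» (B-multi/EDLIST.md multi-E3):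
`tailInvisible` asks the profile to be 1-Lipschitz with `‖g‖ ≤ 1`; the engine only ever used `sup ‖g‖` and the
discrete variation along `z_n = log n / log P` (`KnifeEdgeInvisibleTail.norm_sum_Ioc_char_bvProfile_cpow_le`).  So
the same invisibility holds for every profile of bounded variation on `[1, 1+δ]` — finitely many jumps, kinks, pieces
(the §A evaluator's piecewise class): a design feature placed at `z ≥ 1 + ε` never reaches the main term, smooth or
not.  Consequence recorded by the family planner: no B-multi design carries an off-diagonal `X`-slot (E-002). -/

/-- Bookkeeping (iii′): for bounded-variation data the bracket `B(1 + ‖s‖(1 + 1/σ)) + V` lies in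
`[0, (B + V)(52+δ)𝓛⁵¹⁹]`. [folklore] -/
private theorem budget_bracket_bv {ℓ δ σ ns B V : ℝ} (hδ : 0 < δ) (hℓ1 : 1 ≤ ℓ) (h14 : 1 / 4 ≤ σ)
    (hns0 : 0 ≤ ns) (hns : ns ≤ 2 + 8 * ℓ ^ 519) (hB : 0 ≤ B) (hV : 0 ≤ V) :
    0 ≤ B * (1 + ns * (1 + 1 / σ)) + V ∧
      B * (1 + ns * (1 + 1 / σ)) + V ≤ (B + V) * ((52 + δ) * ℓ ^ 519) := by
  have hσ0 : 0 < σ := by linarith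
  have hσ4 : 1 / σ ≤ 4 := by rw [div_le_iff₀ hσ0]; linarith
  have hσinv0 : 0 ≤ 1 / σ := (one_div_pos.mpr hσ0).le
  have h1 : 0 ≤ ns * (1 + 1 / σ) := mul_nonneg hns0 (by linarith)
  have hℓ0 : 0 ≤ ℓ := by linarith
  have h519 : 1 ≤ ℓ ^ 519 := one_le_pow₀ hℓ1
  have h519' : 0 ≤ ℓ ^ 519 := by linarith
  have hbr : 1 + ns * (1 + 1 / σ) ≤ (52 + δ) * ℓ ^ 519 := by
    have : ns * (1 + 1 / σ) ≤ (2 + 8 * ℓ ^ 519) * 5 :=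
      mul_le_mul hns (by linarith) (by linarith) (by linarith)
    nlinarith
  have hbr1 : 1 ≤ (52 + δ) * ℓ ^ 519 := by nlinarith
  refine ⟨by positivity, ?_⟩
  calc B * (1 + ns * (1 + 1 / σ)) + V
      ≤ B * ((52 + δ) * ℓ ^ 519) + V * ((52 + δ) * ℓ ^ 519) :=
        add_le_add (mul_le_mul_of_nonneg_left hbr hB) (le_mul_of_one_le_right hV hbr1)
    _ = (B + V) * ((52 + δ) * ℓ ^ 519) := by ring

/-- **The invisible tail for profiles of bounded variation (jumps allowed)** — the non-smooth companion of
`tailInvisible` (F-S3, family B-multi, row «E-multi-farjump»): for `0 < ε`, `0 < δ` there is `C > 0` such that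
for all large `D`, every primitive quadratic `χ (mod D)`, every member `x = (p, ψ)` of `Ψ`, every profile
`g : ℝ → ℂ` with `‖g‖ ≤ B` and total variation `≤ V` on `[1, 1+δ]` (`B, V ≥ 0`; no continuity asked), every
`s` with `½ − 1/log P ≤ Re s ≤ 2`, `|Im s| ≤ 8t₀`, and every block `P^{1+ε} ≤ X ≤ Y ≤ P^{1+δ}`:
`‖Σ_{X<n≤Y} χψ(n) g(log n/log P) n^{−s}‖ ≤ C·(B + V)·P^{−ε/4}` (same `C = 4(52+δ)e^{2+ε}` as `tailInvisible`).
Pólya–Vinogradov for `χψ mod Dp` + Abel with sup + variation; a pointwise size statement, NOT a claim about any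
particular design or about the manuscript. [cite: MontgomeryVaughan2007, Thm 9.18]
[cite: Zhang2022LandauSiegel, §4 p. 8; §7 (7.2)] -/
theorem tailInvisible_bv {δ ε : ℝ} (hε : 0 < ε) (hδ : 0 < δ) :
    ∃ C : ℝ, 0 < C ∧ Skeleton.ForAllLarge fun D _ χ =>
      ∀ (x : Skeleton.Chr D) (g : ℝ → ℂ) (B V : ℝ), 0 ≤ B → 0 ≤ V → (∀ z, ‖g z‖ ≤ B) →
        eVariationOn g (Set.Icc 1 (1 + δ)) ≤ ENNReal.ofReal V →
        ∀ s : ℂ, 1 / 2 - 1 / Real.log (Skeleton.bigP D) ≤ s.re → s.re ≤ 2 → |s.im| ≤ 8 * Skeleton.t0 D →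
          ∀ X Y : ℕ, Skeleton.bigP D ^ (1 + ε) ≤ (X : ℝ) → X ≤ Y → (Y : ℝ) ≤ Skeleton.bigP D ^ (1 + δ) →
            ‖∑ n ∈ Finset.Ioc X Y, Skeleton.pc χ x n * g (Real.log n / Real.log (Skeleton.bigP D)) *
                (n : ℂ) ^ (-s)‖ ≤ C * (B + V) * Skeleton.bigP D ^ (-(ε / 4)) := by
  have hC : 0 < 4 * (52 + δ) * Real.exp (2 + ε) := mul_pos (by linarith) (Real.exp_pos _)
  refine ⟨4 * (52 + δ) * Real.exp (2 + ε), hC, ?_⟩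
  refine Skeleton.ForAllLarge.of_le ⌈Real.exp (max 4 (2116 / ε))⌉₊ ?_
  intro D _ χ hD _hquad hχ x g B V hB hV hgB hvar s hσ1 hσ2 hsim X Y hX hXY hY
  -- parameters
  have hℓ : max 4 (2116 / ε) ≤ ell D := le_ell_of_ceil_exp_le hD
  have hℓ4 : 4 ≤ ell D := le_trans (le_max_left _ _) hℓ
  have hℓε : 2116 / ε ≤ ell D := le_trans (le_max_right _ _) hℓ
  have hℓ1 : 1 ≤ ell D := by linarith
  have hℓ0 : 0 < ell D := by linarith
  have hP : 0 < bigP D := Real.exp_pos _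
  have hlogP : Real.log (bigP D) = ell D ^ 9 := by rw [bigP, Real.log_exp]
  have hℓ9 : ell D ≤ ell D ^ 9 := by
    calc ell D = ell D ^ 1 := (pow_one _).symm
      _ ≤ ell D ^ 9 := pow_le_pow_right₀ hℓ1 (by norm_num)
  have hlogP4 : 4 ≤ Real.log (bigP D) := by rw [hlogP]; linarith
  have hlogPpos : 0 < Real.log (bigP D) := by linarith
  -- `D ≥ 3`, `q = Dp ≥ 2`, `χψ` primitive
  have hDpos : (0 : ℝ) < D := by exact_mod_cast Nat.pos_of_ne_zero (NeZero.ne D)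
  have hexpℓ : Real.exp (ell D) = D := by rw [ell]; exact Real.exp_log hDpos
  have hD3r : (3 : ℝ) ≤ D := by
    have h2 : Real.exp 4 ≤ Real.exp (ell D) := Real.exp_le_exp.mpr hℓ4
    have h3 : (4 : ℝ) + 1 ≤ Real.exp 4 := Real.add_one_le_exp 4
    linarith
  have hD3 : 3 ≤ D := by exact_mod_cast hD3r
  have hp2 : 2 ≤ x.p := x.prime.two_le
  have hq : 2 ≤ D * x.p := le_trans (by norm_num) (Nat.mul_le_mul hD3 hp2)
  have hprim : (psiChi χ x).IsPrimitive := psiChiPrimitive_holds D χ x hD3 hχ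
  -- `s`
  have hinv4 : 1 / Real.log (bigP D) ≤ 1 / 4 := one_div_le_one_div_of_le (by norm_num) hlogP4
  have hσpos : 0 < s.re := by linarith
  have h14 : 1 / 4 ≤ s.re := by linarith
  have hsnorm : ‖s‖ ≤ 2 + 8 * ell D ^ 519 := by
    have h1 := Complex.norm_le_abs_re_add_abs_im s
    have h2 : |s.re| ≤ 2 := abs_le.mpr ⟨by linarith, hσ2⟩
    have h3 : |s.im| ≤ 8 * ell D ^ 519 := by simpa only [t0] using hsim
    linarith
  -- `X`, `Y`
  have hP1 : 1 ≤ bigP D := by rw [bigP]; exact Real.one_le_exp (by positivity)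
  have hX1r : (1 : ℝ) ≤ X := le_trans (Real.one_le_rpow hP1 (by linarith)) hX
  have hX1 : 1 ≤ X := by exact_mod_cast hX1r
  have hX0 : (0 : ℝ) < X := by linarith
  have hY0 : (0 : ℝ) < Y := lt_of_lt_of_le hX0 (by exact_mod_cast hXY)
  have hXYr : (X : ℝ) ≤ Y := by exact_mod_cast hXY
  -- the variation on the block's image `[log X/log P, log Y/log P] ⊆ [1, 1+δ]`
  have hsub : Set.Icc (Real.log X / Real.log (bigP D)) (Real.log Y / Real.log (bigP D)) ⊆
      Set.Icc 1 (1 + δ) := by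
    refine Set.Icc_subset_Icc ?_ ?_
    · rw [le_div_iff₀ hlogPpos, one_mul]
      have h1 : Real.log (bigP D ^ (1 + ε)) ≤ Real.log X := Real.log_le_log (Real.rpow_pos_of_pos hP _) hX
      rw [Real.log_rpow hP] at h1
      nlinarith
    · rw [div_le_iff₀ hlogPpos]
      have h1 : Real.log Y ≤ Real.log (bigP D ^ (1 + δ)) := Real.log_le_log hY0 hY
      rwa [Real.log_rpow hP] at h1
  have hvar' : eVariationOn g (Set.Icc (Real.log X / Real.log (bigP D)) (Real.log Y / Real.log (bigP D))) ≤
      ENNReal.ofReal V := (eVariationOn.mono g hsub).trans hvar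
  -- the engine, for `θ = χψ (mod Dp)`, `L = log P`
  have key := norm_sum_Ioc_char_bvProfile_cpow_le_of_eVariationOn hq hprim g hB hV hgB hlogPpos hσpos hX1
    hXY hvar'
  have hsum : ∑ n ∈ Finset.Ioc X Y, Skeleton.pc χ x n * g (Real.log n / Real.log (Skeleton.bigP D)) *
      (n : ℂ) ^ (-s) = ∑ n ∈ Finset.Ioc X Y, psiChi χ x (n : ZMod (D * x.p)) *
        (g (Real.log n / Real.log (Skeleton.bigP D)) * (n : ℂ) ^ (-s)) := by
    refine Finset.sum_congr rfl fun n _ => ?_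
    rw [Section11AFE.psiChi_natCast, mul_assoc]
  rw [hsum]
  refine key.trans ?_
  -- bookkeeping
  have hqr : ((D * x.p : ℕ) : ℝ) ≤ 3 * ((D : ℝ) * Real.exp (ell D ^ 9)) := by
    have := chr_p_le_three_mul_bigP' x hℓ1
    rw [bigP] at this
    push_cast
    nlinarith
  have hq1 : (1 : ℝ) ≤ ((D * x.p : ℕ) : ℝ) := by exact_mod_cast le_trans (by norm_num) hq
  have hi := budget_sqrt_log hℓ4 hexpℓ hq1 hqr
  have hσ1' : 1 / 2 - 1 / ell D ^ 9 ≤ s.re := by rwa [hlogP] at hσ1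
  have hX' : Real.exp (ell D ^ 9) ^ (1 + ε) ≤ (X : ℝ) := by rwa [bigP] at hX
  have hii := budget_X hε hℓ0 hσ1' hσpos hX'
  have hiii := budget_bracket_bv hδ hℓ1 h14 (norm_nonneg s) hsnorm hB hV
  have hiv := budget_final hε hδ hℓ1 hℓε
  have hPε : bigP D ^ (-(ε / 4)) = Real.exp (ell D ^ 9 * (-(ε / 4))) := by rw [bigP, ← Real.exp_mul]
  rw [hPε]
  have hBV : 0 ≤ B + V := add_nonneg hB hV
  have hi0 : 0 ≤ Real.exp ((ell D + 2) / 2) * Real.exp (ell D ^ 9 / 2) * (4 * ell D ^ 9) := by positivity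
  calc Real.sqrt ((D * x.p : ℕ) : ℝ) * (1 + Real.log ((D * x.p : ℕ) : ℝ)) *
        ((X : ℝ) ^ (-s.re) * (B * (1 + ‖s‖ * (1 + 1 / s.re)) + V))
      ≤ (Real.exp ((ell D + 2) / 2) * Real.exp (ell D ^ 9 / 2) * (4 * ell D ^ 9)) *
        (Real.exp (-((1 + ε) * ell D ^ 9 / 2) + (1 + ε)) * ((B + V) * ((52 + δ) * ell D ^ 519))) :=
        mul_le_mul hi (mul_le_mul hii hiii.2 hiii.1 (Real.exp_pos _).le)
          (mul_nonneg (Real.rpow_nonneg hX0.le _) hiii.1) hi0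
    _ = (B + V) * ((Real.exp ((ell D + 2) / 2) * Real.exp (ell D ^ 9 / 2)) * (4 * ell D ^ 9) *
        (Real.exp (-((1 + ε) * ell D ^ 9 / 2) + (1 + ε)) * ((52 + δ) * ell D ^ 519))) := by ring
    _ ≤ (B + V) * (4 * (52 + δ) * Real.exp (2 + ε) * Real.exp (ell D ^ 9 * (-(ε / 4)))) :=
        mul_le_mul_of_nonneg_left hiv hBV
    _ = 4 * (52 + δ) * Real.exp (2 + ε) * (B + V) * Real.exp (ell D ^ 9 * (-(ε / 4))) := by ring


end Family

end Literature.NumberTheory.LFunctions.Zhang2022.KnifeEdgeInvisibleTail
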